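import Mathlib.Analysis.SpecialFunctions.Pow.Real

/-!
# K1loc, line `Spectral` / thin start — helper: THE THIN BLOCK GEOMETRY (arithmetic head, then doubling) for the strip steps of the thin phases

Helper file of the prover lane on the crux `K1LocalisedCascade` (stmt-AnomalousDissipation-19491), route `SawtoothPulseCascade`
(glue seat; numeric layer — item 2 of the assembly spec of record, `HOME/ad-k1loc-p2/ASSEMBLY-SPEC-k1locp2g6.md` §4).  In the THIN
phases (`K_{j+1} = (γ²−3)K_j`, needed for the rate) the strip windows (S-V)/(T-H) of `K1Window.tsum_strip_vstep_blocks_le` /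
`tsum_lowFibre_hstep_blocks_le` sit just below the chirp shift: at the fibre floor `Λ₀` the margin `GΛ₀ − K` is a few percent of
`GΛ₀`, so the first fibre blocks cannot double (`…CanonicalBlocks`) — they must grow arithmetically until the margin is comfortable.
This file is the `…CanonicalBlocks` analogue for that geometry, with ONE closed-form monotone block family and cut-offs that are
uniform over head and tail:
* §1 blocks `Λ_m = (Λ₀ + s·min(m,H))·2^{m−H}` (ℕ-subtraction: `= Λ₀ + s·m` on the head `m ≤ H`, `= Λ_H·2^{m−H}` on the tail):
  `thin_blocks_head/_tail/_zero/_ge/_monotone/_succ_head/_succ_tail`;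
* §2 cut-offs: feed cut-off `Q₁^m = ⌊u′Λ_{m+1}/v′⌋` (`thin_feed`: `u′Λ_{m+1} ≤ v′(Q₁^m+1)` for ANY block family) and window top at a fixed
  fraction of the margin, `Q₂^m = ⌊θ_n(GΛ_m − K)/θ_d⌋` (`θ_n < θ_d`): `thin_strip_shift` (`K + Q₂^m < Λ_mG` for every block from `K < GΛ₀`
  alone), `thin_sep_all` / `thin_Q₁_lt_Q₂` (the separation `θ_d(u′Λ_{m+1} + v′) ≤ v′θ_n(GΛ_m − K)` for ALL `m` from its instances at
  `m = 0` and `m = H` plus the increment condition `θ_du′ ≤ v′θ_nG`), `thin_Q₁_mono` (for `hY`);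
* §3 block constants against the margin `marg = GΛ − K`: `A ≤ ((1−θ)K + (1+θ)GΛ)/((1−θ)·marg)` (`thin_A_le`), `τ ≤ π/((1−θ)·marg)`
  (`thin_tau_le`), in the exact syntactic shape of the `hAd`/`hε` hypotheses of `…StripBlocks`; cut-off ratio `r ≤ (1+c_n/c_d)/(1−c_n/c_d)`
  under `c_d·u′Λ_{m+1} ≤ c_n·v′·Q₂^m` (`thin_r_le`);
* §4 the head margins are an arithmetic progression (`thin_margin_head`) and `Σ_{m<H} 1/(a + bm)² ≤ 1/a² + 1/(ab)` (`sum_inv_sq_arith_le`) —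
  the head part of the block junk sum converges although the constants `A_m ~ 2GΛ_m/marg_m` are large on the first blocks.
The tail `m ≥ H` is the doubling regime of `…CanonicalBlocks`/`…BlockJunk` at the floor `Λ_H` (margin `GΛ_H − K ≥` a fixed fraction of
`GΛ_H`).  Pure natural/real arithmetic; no definitions; no statement about the crux. [cite: Grafakos2014, Prop. 3.2.7 (3)] [problem: turb]
-/

-- `Summit.<Summit>.<Problem>`: single-conjunct summit, the duplicate namespace segment is deliberate.
set_option linter.dupNamespace false

noncomputable section

namespace Summit.AnomalousDissipation.AnomalousDissipation.Theorems.SawtoothPulseCascade.K1Window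

open Finset

/-! ## §1 The block family `Λ_m = (Λ₀ + s·min(m,H))·2^{m−H}` -/

/-- **Head blocks**: for `m ≤ H`, `Λ_m = Λ₀ + s·m`. [folklore] -/
theorem thin_blocks_head {Λ0 s H m : ℕ} (h : m ≤ H) : (Λ0 + s * min m H) * 2 ^ (m - H) = Λ0 + s * m := by
  rw [min_eq_left h, Nat.sub_eq_zero_of_le h, pow_zero, mul_one]

/-- **Tail blocks**: for `H ≤ m`, `Λ_m = (Λ₀ + s·H)·2^{m−H}`. [folklore] -/
theorem thin_blocks_tail {Λ0 s H m : ℕ} (h : H ≤ m) : (Λ0 + s * min m H) * 2 ^ (m - H) = (Λ0 + s * H) * 2 ^ (m - H) := by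
  rw [min_eq_right h]

/-- The floor: `Λ_0 = Λ₀`. [folklore] -/
theorem thin_blocks_zero (Λ0 s H : ℕ) : (Λ0 + s * min 0 H) * 2 ^ (0 - H) = Λ0 := by simp

/-- **Head increments**: for `m < H`, `Λ_{m+1} = Λ_m + s`. [folklore] -/
theorem thin_blocks_succ_head {Λ0 s H m : ℕ} (h : m < H) :
    (Λ0 + s * min (m + 1) H) * 2 ^ (m + 1 - H) = (Λ0 + s * min m H) * 2 ^ (m - H) + s := by
  rw [thin_blocks_head (Nat.succ_le_of_lt h), thin_blocks_head h.le, Nat.mul_succ]; omega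

/-- **Tail increments**: for `H ≤ m`, `Λ_{m+1} = 2·Λ_m`. [folklore] -/
theorem thin_blocks_succ_tail {Λ0 s H m : ℕ} (h : H ≤ m) :
    (Λ0 + s * min (m + 1) H) * 2 ^ (m + 1 - H) = 2 * ((Λ0 + s * min m H) * 2 ^ (m - H)) := by
  rw [thin_blocks_tail h, thin_blocks_tail (h.trans (Nat.le_succ m)), Nat.succ_sub h, pow_succ]; ring

/-- **The block family is monotone** (the `hΛb` hypothesis of the block steps). [folklore] -/
theorem thin_blocks_monotone (Λ0 s H : ℕ) : Monotone fun m : ℕ => (Λ0 + s * min m H) * 2 ^ (m - H) := by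
  refine monotone_nat_of_le_succ fun m => ?_
  rcases lt_or_ge m H with h | h
  · simp only [thin_blocks_succ_head h]; exact Nat.le_add_right _ _
  · simp only [thin_blocks_succ_tail h]; omega

/-- **Every block edge is at least the floor**: `Λ₀ ≤ Λ_m` (so `1 ≤ Λ₀` gives `hΛ0`). [folklore] -/
theorem thin_blocks_ge (Λ0 s H m : ℕ) : Λ0 ≤ (Λ0 + s * min m H) * 2 ^ (m - H) := by
  have h := thin_blocks_monotone Λ0 s H (Nat.zero_le m)
  simpa using h

/-- Head blocks stay below the last head edge: `m ≤ H → Λ_m ≤ Λ_H = Λ₀ + sH`. [folklore] -/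
theorem thin_blocks_head_le {Λ0 s H m : ℕ} (h : m ≤ H) : (Λ0 + s * min m H) * 2 ^ (m - H) ≤ Λ0 + s * H := by
  rw [thin_blocks_head h]; exact Nat.add_le_add_left (Nat.mul_le_mul_left _ h) _

/-- Consecutive edges differ by at most the factor `2` once `s ≤ Λ₀`. [folklore] -/
theorem thin_blocks_succ_le_two_mul {Λ0 s H : ℕ} (hs : s ≤ Λ0) (m : ℕ) :
    (Λ0 + s * min (m + 1) H) * 2 ^ (m + 1 - H) ≤ 2 * ((Λ0 + s * min m H) * 2 ^ (m - H)) := by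
  rcases lt_or_ge m H with h | h
  · rw [thin_blocks_succ_head h]
    have := thin_blocks_ge Λ0 s H m
    omega
  · rw [thin_blocks_succ_tail h]

/-! ## §2 Cut-offs: the feed cut-off `Q₁ = ⌊u′Λ_{m+1}/v′⌋` and the window top `Q₂ = ⌊θ_n(GΛ − K)/θ_d⌋` -/

/-- **The feed inclusion, for any block family**: `u′L ≤ v′(⌊u′L/v′⌋ + 1)` (take `L = Λ_{m+1}`; this is the `hfeed` hypothesis of the
block steps with `Q₁^m := ⌊u′Λ_{m+1}/v′⌋`). [folklore] -/
theorem thin_feed (u' : ℕ) {v' : ℕ} (hv' : 0 < v') (L : ℕ) : u' * L ≤ v' * (u' * L / v' + 1) := by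
  have h := Nat.lt_div_mul_add (a := u' * L) hv'
  rw [Nat.mul_add, mul_comm v' (u' * L / v')]
  omega

/-- The feed cut-off is monotone in the block (so `Y ≤ Q₁^0 + 1` gives `hY` on every block). [folklore] -/
theorem thin_Q₁_mono (u' v' : ℕ) {Λb : ℕ → ℕ} (hΛb : Monotone Λb) : Monotone fun m => u' * Λb (m + 1) / v' :=
  fun _ _ h => Nat.div_le_div_right (Nat.mul_le_mul_left _ (hΛb (Nat.succ_le_succ h)))

/-- **The window top stays below the chirp shift on EVERY block**: `θ_n < θ_d` and `K < GΛ` give `K + ⌊θ_n(GΛ − K)/θ_d⌋ < ΛG`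
(the `hΛQ` hypothesis of `…StripBlocks`, with no per-block check: the margin `GΛ − K` only grows along a monotone family). [folklore] -/
theorem thin_strip_shift {θn θd G K Λ : ℕ} (hθ : θn < θd) (hK : K < G * Λ) : K + θn * (G * Λ - K) / θd < Λ * G := by
  have hx : 0 < G * Λ - K := Nat.sub_pos_of_lt hK
  have h1 : θn * (G * Λ - K) / θd < G * Λ - K := Nat.div_lt_of_lt_mul (Nat.mul_lt_mul_of_pos_right hθ hx)
  have : K + (G * Λ - K) = G * Λ := Nat.add_sub_cancel' hK.le
  rw [mul_comm Λ G]; omega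

/-- `K < GΛ₀` propagates along the blocks: `Λ₀ ≤ Λ` gives `K < GΛ`. [folklore] -/
theorem thin_K_lt_of_le {G K Λ0 Λ : ℕ} (hK : K < G * Λ0) (hΛ : Λ0 ≤ Λ) : K < G * Λ :=
  lt_of_lt_of_le hK (Nat.mul_le_mul_left _ hΛ)

/-- **Separation of the cut-offs on every block from three scalar facts**: with `Λ_m = (Λ₀ + s·min(m,H))·2^{m−H}`, if
(i) `θ_d(u′Λ_1 + v′) ≤ v′θ_n(GΛ_0 − K)` (first head block), (ii) `θ_du′ ≤ v′θ_nG` (the window top outruns the feed cut-off along the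
head), (iii) `θ_d(u′Λ_{H+1} + v′) ≤ v′θ_n(GΛ_H − K)` (first tail block) and `K ≤ GΛ₀`, then
`θ_d(u′Λ_{m+1} + v′) ≤ v′θ_n(GΛ_m − K)` for EVERY `m`. [folklore] -/
theorem thin_sep_all {Λ0 s H u' v' θn θd G K : ℕ} (hK : K ≤ G * Λ0)
    (h0 : θd * (u' * ((Λ0 + s * min 1 H) * 2 ^ (1 - H)) + v') ≤ v' * θn * (G * Λ0 - K))
    (hinc : θd * u' ≤ v' * θn * G)
    (hH : θd * (u' * ((Λ0 + s * min (H + 1) H) * 2 ^ (H + 1 - H)) + v') ≤ v' * θn * (G * (Λ0 + s * H) - K)) (m : ℕ) :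
    θd * (u' * ((Λ0 + s * min (m + 1) H) * 2 ^ (m + 1 - H)) + v') ≤
      v' * θn * (G * ((Λ0 + s * min m H) * 2 ^ (m - H)) - K) := by
  induction m with
  | zero => simpa using h0
  | succ n ih =>
    rcases lt_or_ge (n + 1) H with h | h
    · -- inside the head: both edges move by `s`
      rw [thin_blocks_succ_head h, thin_blocks_head h.le]
      have hn : n < H := Nat.lt_of_succ_lt h
      rw [thin_blocks_succ_head hn, thin_blocks_head hn.le] at ih
      have hKn : K ≤ G * (Λ0 + s * n) := hK.trans (Nat.mul_le_mul_left _ (Nat.le_add_right _ _))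
      have e1 : G * (Λ0 + s * (n + 1)) - K = (G * (Λ0 + s * n) - K) + G * s := by
        rw [show G * (Λ0 + s * (n + 1)) = G * (Λ0 + s * n) + G * s by ring]; omega
      rw [e1]
      have hstep : θd * (u' * s) ≤ v' * θn * (G * s) := by
        calc θd * (u' * s) = θd * u' * s := by ring
          _ ≤ v' * θn * G * s := Nat.mul_le_mul_right _ hinc
          _ = v' * θn * (G * s) := by ring
      calc θd * (u' * (Λ0 + s * (n + 1) + s) + v') = θd * (u' * (Λ0 + s * n + s) + v') + θd * (u' * s) := by ring
        _ ≤ v' * θn * (G * (Λ0 + s * n) - K) + v' * θn * (G * s) := Nat.add_le_add ih hstep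
        _ = v' * θn * (G * (Λ0 + s * n) - K + G * s) := by ring
    · rcases eq_or_lt_of_le h with h' | h'
      · -- the first tail block: hypothesis (iii)
        subst h'
        rw [thin_blocks_head le_rfl]
        exact hH
      · -- inside the tail: both sides (at least) double
        have hn : H ≤ n := Nat.le_of_lt_succ h'
        rw [thin_blocks_succ_tail (hn.trans (Nat.le_succ n)), thin_blocks_tail (hn.trans (Nat.le_succ n))]
        rw [thin_blocks_succ_tail hn, thin_blocks_tail hn] at ih
        set L := (Λ0 + s * H) * 2 ^ (n - H) with hL
        have eL : (Λ0 + s * H) * 2 ^ (n + 1 - H) = 2 * L := by rw [hL, Nat.succ_sub hn, pow_succ]; ring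
        rw [eL]
        -- `θd(u'·4L + v') ≤ 2·θd(u'·2L + v') ≤ 2·v'θn(GL − K) ≤ v'θn(2GL − K)`
        have h2 : θd * (u' * (2 * (2 * L)) + v') ≤ 2 * (θd * (u' * (2 * L) + v')) := by nlinarith
        have e3 : 2 * (G * L - K) ≤ G * (2 * L) - K := by
          have : G * (2 * L) = 2 * (G * L) := by ring
          omega
        calc θd * (u' * (2 * (2 * L)) + v') ≤ 2 * (θd * (u' * (2 * L) + v')) := h2
          _ ≤ 2 * (v' * θn * (G * L - K)) := Nat.mul_le_mul_left _ ih
          _ = v' * θn * (2 * (G * L - K)) := by ring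
          _ ≤ v' * θn * (G * (2 * L) - K) := Nat.mul_le_mul_left _ e3

/-- **The cut-offs are separated**: `θ_d(u′Λ′ + v′) ≤ v′θ_n(GΛ − K)` (`v′, θ_d > 0`) gives `⌊u′Λ′/v′⌋ < ⌊θ_n(GΛ − K)/θ_d⌋`
(the `hQ` hypothesis of the block steps). [folklore] -/
theorem thin_Q₁_lt_Q₂ {u' v' θn θd G K Λ Λ' : ℕ} (hv' : 0 < v') (hθd : 0 < θd)
    (hsep : θd * (u' * Λ' + v') ≤ v' * θn * (G * Λ - K)) : u' * Λ' / v' < θn * (G * Λ - K) / θd := by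
  -- `(Q₁ + 1)·θ_d ≤ θ_n(GΛ − K)` since `v′Q₁ ≤ u′Λ′`
  have hfloor : v' * (u' * Λ' / v') ≤ u' * Λ' := Nat.mul_div_le _ _
  have key : (u' * Λ' / v' + 1) * θd ≤ θn * (G * Λ - K) := by
    refine Nat.le_of_mul_le_mul_left ?_ hv'
    calc v' * ((u' * Λ' / v' + 1) * θd) = θd * (v' * (u' * Λ' / v') + v') := by ring
      _ ≤ θd * (u' * Λ' + v') := Nat.mul_le_mul_left _ (Nat.add_le_add_right hfloor _)
      _ ≤ v' * θn * (G * Λ - K) := hsep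
      _ = v' * (θn * (G * Λ - K)) := by ring
  have h2 : u' * Λ' / v' + 1 ≤ θn * (G * Λ - K) / θd := (Nat.le_div_iff_mul_le hθd).mpr key
  omega

/-! ## §3 Block constants against the margin `GΛ − K` -/

/-- The window top is at most the fraction `θ = θ_n/θ_d` of the margin: `⌊θ_n(GΛ−K)/θ_d⌋ ≤ θ·(GΛ − K)` in `ℝ` (`K ≤ GΛ`, `θ_d > 0`).
[folklore] -/
theorem thin_Q₂_le {θn θd G K Λ : ℕ} (hθd : 0 < θd) (hK : K ≤ G * Λ) :
    ((θn * (G * Λ - K) / θd : ℕ) : ℝ) ≤ (θn : ℝ) / θd * ((G : ℝ) * Λ - K) := by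
  have h := Nat.cast_div_le (m := θn * (G * Λ - K)) (n := θd) (α := ℝ)
  have hθdr : (0 : ℝ) < θd := by exact_mod_cast hθd
  refine h.trans (le_of_eq ?_)
  rw [Nat.cast_mul, Nat.cast_sub hK, Nat.cast_mul]
  field_simp

/-- **The block denominator is a fixed fraction of the margin**: `ΛG − (K + Q₂) ≥ (1 − θ)(GΛ − K) > 0` (`θ_n < θ_d`, `K < GΛ`). [folklore] -/
theorem thin_den_ge {θn θd G K Λ : ℕ} (hθd : 0 < θd) (hθ : θn < θd) (hK : K < G * Λ) :
    0 < (1 - (θn : ℝ) / θd) * ((G : ℝ) * Λ - K) ∧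
      (1 - (θn : ℝ) / θd) * ((G : ℝ) * Λ - K) ≤ ((Λ * G : ℕ) : ℝ) - ((K + θn * (G * Λ - K) / θd : ℕ) : ℝ) := by
  have hQ := thin_Q₂_le (θn := θn) hθd hK.le
  have hθdr : (0 : ℝ) < θd := by exact_mod_cast hθd
  have hθr : (θn : ℝ) / θd < 1 := by rw [div_lt_one hθdr]; exact_mod_cast hθ
  have hKr : (K : ℝ) < (G : ℝ) * Λ := by exact_mod_cast hK
  refine ⟨mul_pos (by linarith) (by linarith), ?_⟩
  push_cast
  nlinarith

/-- **RATIO constant of a thin strip block**: with `θ = θ_n/θ_d < 1` and `K < GΛ`,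
`A = (K + Q₂ + ΛG)/(ΛG − K − Q₂) ≤ ((1−θ)K + (1+θ)GΛ)/((1−θ)(GΛ − K))` (`Q₂ = ⌊θ_n(GΛ−K)/θ_d⌋`; the syntactic `A` of the `hAd`/`hε`
hypotheses of `K1Window.tsum_strip_vstep_blocks_le` / `tsum_lowFibre_hstep_blocks_le`). [folklore] -/
theorem thin_A_le {θn θd G K Λ : ℕ} (hθd : 0 < θd) (hθ : θn < θd) (hK : K < G * Λ) :
    (((K + θn * (G * Λ - K) / θd : ℕ) : ℝ) + ((Λ * G : ℕ) : ℝ)) /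
        (((Λ * G : ℕ) : ℝ) - ((K + θn * (G * Λ - K) / θd : ℕ) : ℝ)) ≤
      ((1 - (θn : ℝ) / θd) * K + (1 + (θn : ℝ) / θd) * ((G : ℝ) * Λ)) / ((1 - (θn : ℝ) / θd) * ((G : ℝ) * Λ - K)) := by
  have hden := thin_den_ge hθd hθ hK
  have hQ := thin_Q₂_le (θn := θn) hθd hK.le
  have hθdr : (0 : ℝ) < θd := by exact_mod_cast hθd
  have hθ0 : (0 : ℝ) ≤ (θn : ℝ) / θd := by positivity
  have hKr : (K : ℝ) < (G : ℝ) * Λ := by exact_mod_cast hK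
  set θ : ℝ := (θn : ℝ) / θd with hθdef
  set L : ℝ := (G : ℝ) * Λ with hL
  set q : ℝ := ((θn * (G * Λ - K) / θd : ℕ) : ℝ) with hq
  have hq0 : 0 ≤ q := Nat.cast_nonneg _
  have eLG : ((Λ * G : ℕ) : ℝ) = L := by rw [hL]; push_cast; ring
  have eKQ : ((K + θn * (G * Λ - K) / θd : ℕ) : ℝ) = (K : ℝ) + q := by rw [hq]; push_cast; ring
  rw [eLG, eKQ] at hden ⊢
  have hD : 0 < L - ((K : ℝ) + q) := lt_of_lt_of_le hden.1 hden.2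
  rw [div_le_div_iff₀ hD hden.1]
  -- `p ↦ (p + L)/(L − p)` is increasing: with `p = K + q ≤ K + θ(L − K) = p*`
  have hp : (K : ℝ) + q ≤ K + θ * (L - K) := by linarith
  have hnum0 : 0 ≤ (K : ℝ) + q + L := by have : (0 : ℝ) ≤ K := Nat.cast_nonneg _; linarith
  calc ((K : ℝ) + q + L) * ((1 - θ) * (L - K)) = ((K : ℝ) + q + L) * (L - (K + θ * (L - K))) := by ring
    _ ≤ ((K : ℝ) + q + L) * (L - (K + q)) := mul_le_mul_of_nonneg_left (by linarith) hnum0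
    _ ≤ ((1 - θ) * K + (1 + θ) * L) * (L - (K + q)) := by
        refine mul_le_mul_of_nonneg_right ?_ hD.le
        linarith

/-- **LAYER constant of a thin strip block**: `τ = π/(ΛG − K − Q₂) ≤ π/((1−θ)(GΛ − K))`. [folklore] -/
theorem thin_tau_le {θn θd G K Λ : ℕ} (hθd : 0 < θd) (hθ : θn < θd) (hK : K < G * Λ) :
    Real.pi / (((Λ * G : ℕ) : ℝ) - ((K + θn * (G * Λ - K) / θd : ℕ) : ℝ)) ≤
      Real.pi / ((1 - (θn : ℝ) / θd) * ((G : ℝ) * Λ - K)) := by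
  have hden := thin_den_ge hθd hθ hK
  exact div_le_div_of_nonneg_left Real.pi_pos.le hden.1 hden.2

/-- **The product `A·τ` of a thin strip block** (the kernel-layer junk is `64·N·A·τ` per block):
`A·τ ≤ π((1−θ)K + (1+θ)GΛ)/((1−θ)²(GΛ − K)²)`. [folklore] -/
theorem thin_A_mul_tau_le {θn θd G K Λ : ℕ} (hθd : 0 < θd) (hθ : θn < θd) (hK : K < G * Λ) :
    (((K + θn * (G * Λ - K) / θd : ℕ) : ℝ) + ((Λ * G : ℕ) : ℝ)) /
          (((Λ * G : ℕ) : ℝ) - ((K + θn * (G * Λ - K) / θd : ℕ) : ℝ)) *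
        (Real.pi / (((Λ * G : ℕ) : ℝ) - ((K + θn * (G * Λ - K) / θd : ℕ) : ℝ))) ≤
      Real.pi * ((1 - (θn : ℝ) / θd) * K + (1 + (θn : ℝ) / θd) * ((G : ℝ) * Λ)) /
        ((1 - (θn : ℝ) / θd) ^ 2 * ((G : ℝ) * Λ - K) ^ 2) := by
  have hA := thin_A_le hθd hθ hK
  have hτ := thin_tau_le hθd hθ hK
  have hden := thin_den_ge hθd hθ hK
  have hA0 : 0 ≤ (((K + θn * (G * Λ - K) / θd : ℕ) : ℝ) + ((Λ * G : ℕ) : ℝ)) /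
      (((Λ * G : ℕ) : ℝ) - ((K + θn * (G * Λ - K) / θd : ℕ) : ℝ)) :=
    div_nonneg (by positivity) (hden.1.le.trans hden.2)
  have hτ0 : 0 ≤ Real.pi / ((1 - (θn : ℝ) / θd) * ((G : ℝ) * Λ - K)) := div_nonneg Real.pi_pos.le hden.1.le
  refine (mul_le_mul hA hτ (div_nonneg Real.pi_pos.le (hden.1.le.trans hden.2)) (hA0.trans hA)).trans (le_of_eq ?_)
  have h1 : (1 - (θn : ℝ) / θd) * ((G : ℝ) * Λ - K) ≠ 0 := hden.1.ne'
  field_simp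

/-- **The cut-off RATIO of a thin block**: if the feed cut-off is at most the fraction `c = c_n/c_d < 1` of the window top,
`c_d·u′Λ′ ≤ c_n·v′·Q₂` (`v′, c_d > 0`, `Q₁ = ⌊u′Λ′/v′⌋ < Q₂`), then `(Q₁ + Q₂)/(Q₂ − Q₁) ≤ (c_d + c_n)/(c_d − c_n)`. [folklore] -/
theorem thin_r_le {u' v' cn cd Λ' Q₂ : ℕ} (hv' : 0 < v') (hcd : 0 < cd) (hc : cn < cd) (hQ : u' * Λ' / v' < Q₂)
    (hfrac : cd * (u' * Λ') ≤ cn * (v' * Q₂)) :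
    (((u' * Λ' / v' : ℕ) : ℝ) + Q₂) / ((Q₂ : ℝ) - ((u' * Λ' / v' : ℕ) : ℝ)) ≤ ((cd : ℝ) + cn) / ((cd : ℝ) - cn) := by
  have hv'r : (0 : ℝ) < v' := by exact_mod_cast hv'
  have hcdr : (0 : ℝ) < cd := by exact_mod_cast hcd
  have hcr : (cn : ℝ) < cd := by exact_mod_cast hc
  set Q₁ : ℝ := ((u' * Λ' / v' : ℕ) : ℝ) with hQ₁
  have hQ1le : Q₁ ≤ (u' : ℝ) * Λ' / v' := by
    have h := Nat.cast_div_le (m := u' * Λ') (n := v') (α := ℝ)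
    rw [hQ₁]; push_cast at h ⊢; exact h
  have hfr : (cd : ℝ) * ((u' : ℝ) * Λ') ≤ cn * ((v' : ℝ) * Q₂) := by exact_mod_cast hfrac
  have hQ1c : (cd : ℝ) * Q₁ ≤ cn * Q₂ := by
    have h1 : (cd : ℝ) * Q₁ ≤ cd * ((u' : ℝ) * Λ' / v') := mul_le_mul_of_nonneg_left hQ1le hcdr.le
    have h2 : (cd : ℝ) * ((u' : ℝ) * Λ' / v') ≤ cn * Q₂ := by
      rw [← mul_div_assoc, div_le_iff₀ hv'r]; linarith
    exact h1.trans h2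
  have hlt : Q₁ < Q₂ := by rw [hQ₁]; exact_mod_cast hQ
  have hQ1n : 0 ≤ Q₁ := Nat.cast_nonneg _
  rw [div_le_div_iff₀ (by linarith) (by linarith)]
  nlinarith

/-! ## §4 Head margins and the convergent head sum -/

/-- **Head margins form an arithmetic progression**: for `m ≤ H` and `K ≤ GΛ₀`, `GΛ_m − K = (GΛ₀ − K) + G·s·m` (in `ℕ`). [folklore] -/
theorem thin_margin_head {Λ0 s H G K m : ℕ} (h : m ≤ H) (hK : K ≤ G * Λ0) :
    G * ((Λ0 + s * min m H) * 2 ^ (m - H)) - K = (G * Λ0 - K) + G * s * m := by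
  rw [thin_blocks_head h, show G * (Λ0 + s * m) = G * Λ0 + G * s * m by ring]
  omega

/-- Real form of the head margin: `G·Λ_m − K = (GΛ₀ − K) + G·s·m` for `m ≤ H`. [folklore] -/
theorem thin_margin_head_real {Λ0 s H G K m : ℕ} (h : m ≤ H) :
    (G : ℝ) * (((Λ0 + s * min m H) * 2 ^ (m - H) : ℕ) : ℝ) - K = ((G : ℝ) * Λ0 - K) + (G : ℝ) * s * m := by
  rw [thin_blocks_head h]; push_cast; ring

/-- **The convergent head sum** (telescoping): for `a, b > 0` and every `n`,
`Σ_{m ≤ n} 1/(a + bm)² ≤ 1/a² + 1/(ab) − 1/(b(a + bn))`. [folklore] -/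
theorem sum_inv_sq_arith_le_sub {a b : ℝ} (ha : 0 < a) (hb : 0 < b) (n : ℕ) :
    ∑ m ∈ range (n + 1), 1 / (a + b * m) ^ 2 ≤ 1 / a ^ 2 + 1 / (a * b) - 1 / (b * (a + b * n)) := by
  induction n with
  | zero =>
    rw [zero_add, sum_range_one, Nat.cast_zero, mul_zero, add_zero, mul_comm b a]
    linarith
  | succ n ih =>
    rw [sum_range_succ]
    have hx : 0 < a + b * n := by positivity
    have hx1 : 0 < a + b * ((n + 1 : ℕ) : ℝ) := by positivity
    -- the new term is at most the telescoping increment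
    have hterm : 1 / (a + b * ((n + 1 : ℕ) : ℝ)) ^ 2 ≤ 1 / (b * (a + b * n)) - 1 / (b * (a + b * ((n + 1 : ℕ) : ℝ))) := by
      have e : 1 / (b * (a + b * n)) - 1 / (b * (a + b * ((n + 1 : ℕ) : ℝ))) =
          1 / ((a + b * n) * (a + b * ((n + 1 : ℕ) : ℝ))) := by
        field_simp
        push_cast
        ring
      rw [e, one_div_le_one_div (by positivity) (by positivity)]
      have : a + b * (n : ℝ) ≤ a + b * ((n + 1 : ℕ) : ℝ) := by push_cast; nlinarith
      nlinarith
    linarith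

/-- **The convergent head sum**: `Σ_{m<H} 1/(a + bm)² ≤ 1/a² + 1/(ab)` for `a, b > 0` — with `a = GΛ₀ − K` (margin at the floor) and
`b = G·s` (head increment) this bounds `Σ_head A_mτ_m ∝ Σ 1/marg_m²` although `A_0 ~ 2GΛ₀/(GΛ₀ − K)` is large. [folklore] -/
theorem sum_inv_sq_arith_le {a b : ℝ} (ha : 0 < a) (hb : 0 < b) (H : ℕ) :
    ∑ m ∈ range H, 1 / (a + b * m) ^ 2 ≤ 1 / a ^ 2 + 1 / (a * b) := by
  rcases Nat.eq_zero_or_pos H with rfl | hH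
  · simp only [range_zero, sum_empty]; positivity
  · obtain ⟨n, rfl⟩ := Nat.exists_eq_add_of_le' hH
    refine (sum_inv_sq_arith_le_sub ha hb n).trans ?_
    have : 0 ≤ 1 / (b * (a + b * n)) := by positivity
    linarith

end Summit.AnomalousDissipation.AnomalousDissipation.Theorems.SawtoothPulseCascade.K1Window
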